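import Literature.MathematicalPhysics.QuantumFieldTheory.Balaban1983to89.B13OpsYPencilGreen
import Literature.MathematicalPhysics.QuantumFieldTheory.Balaban1983to89.B13DeltaAPencilLettersLocated

/-!
# `Balaban1983to89.B13GreenStationLocated` — T. Bałaban, *Propagators for lattice gauge theories in a background field*, Commun. Math. Phys. **99** (1985) 389–434
# [Balaban1985BackgroundPropagators], (3.3) p. 391 and (3.8) p. 392 (`D_U`, `D*_U`), (3.25)–(3.27) pp. 394–395 (`R(U)`, `Δ_a(U) = Δ(U) + D_U R(U) D*_U + Q*(U)aQ(U)`,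
# `G(U) = Δ_a(U)⁻¹`), Thm 3.4 and (3.50) p. 400, (3.84)–(3.86) p. 407, Thm 3.10 (3.107)–(3.108) p. 416; *Renormalization group approach to lattice gauge field theories. II*,
# Commun. Math. Phys. **116** (1988) 1–22 [Balaban1988RG2Cluster], (2.5)–(2.7) pp. 12–13, p. 15: ★★★ dag-n10-w2's G-STATION (`B13OpsYPencilGreen` §4) LOCATED — the gradient's
# row ∕ column sums as numbers (`C_∂ = C_∂* = 2|c_f|`) and EVERY NODE-00 numeral of the station a number at `(M_N(ℂ), matrix units, fineReadingY ∕ bondReadingY, G ≤ U(N))`.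

THE DISPLAY OF THE G-STATION.  dag-n10-w2's `B13OpsYPencilGreen.rawEntryLetters_toMatrix_GAY_prodCfg_of_pencil` reads print's Sect. B chain `R → Δ_a → G` at NODE 00's operators
along pv27's pencil: from R's pencil letters (`hR`, the R-station's output — hence G′'s and X⁻¹'s), the LOCAL part's pencil letters (`hLoc`), N06's content at the real
background (`hunit`, `hO`) and NUMERALS — the background size `K₀`, the gradient ∕ divergence row sums `C_∂ ∕ C_∂*` (`hCgR ∕ hCdC`; print: `2`), the basis numerals
`cb cl`, the readings `ℓS ∕ ℓF` with ONE range numeral `r′` (`hℓG ∕ hℓD`) and a fibre bound `m_F` — it concludes the N10 letters of `A′ ↦ toMatrix (G(e^{iηA′}U₀))`.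
After this seat's `B13DeltaAPencilLettersLocated` (76 §4 located = `hLoc` with every numeral a number) the station's remaining NODE-00 numerals are `C_∂ ∕ C_∂*`: §1
proves them — `Σ_z |∂(b,z)| ≤ 2|c_f|` and `Σ_z |∂*(z,b)| ≤ 2|c_f|` (the gradient kernel is supported on the bond's two ends, `Node00.gradK_ne_zero_cases`, with entries
`±c_f`, n06's `B9Eq3104CutoffCommutatorSizes.abs_gradK_le`; `∂* = ∂ᵀ`, `Node00.divK_eq_transpose`).  §2 is the station LOCATED: `hLoc :=` 76 §4 located, `C_∂ = C_∂* = 2|c_f|`,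
`r′ = 1` and `m_F = (d+1)·N²` (this seat's `B13BlockBondReadingNumerals.hℓG_bondReadingY ∕ hℓD_bondReadingY ∕ card_fibre_bondReadingY_matrixUnits` at `ℓS := fineReadingY`,
`ℓF := bondReadingY`), `K₀ = 1` (79 `norm_unit_le_one_of_mem`), `cb = cl = 1` (dag-n10-w2's `B13MatrixUnitBasisNumerals`) — displaying ONLY the R-station's output `hR` (at the
fine reading), N06's `IsUnit (Δ_a(U₀))` and pointwise (3.108)-type bound, `hG`, `hU₀`, `hNf`, `η`, `0 < Rd`, `0 ≤ ρ′ < ρ`.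

[folklore] finite-lattice bookkeeping (§1) + ONE positional application of a cited tree theorem (§2); kernel-checked; THEOREMS ONLY (no `def`, no `structure`, no instance,
no notation; `open scoped Matrix.Norms.L2Operator` = the record's norm); NOTHING of NODE 00's ∕ pv27's ∕ dag-n10-w2's ∕ the cited numeral files is modified; nothing here is a
claim about the Yang–Mills mass gap; no node is discharged; count-neutral.

WHY THIS FILE (cell `pub-ymgap`, HUMAN RULING D-0062 ∕ D-0149, Track A node N10 = [B13]; WIDTH SEAT `pub-ymgap-dag-n10-w4` g5, CLAIM-3 (R455 (A)) = the offer (o1) of bus I.35001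
to dag-n10-w2; lane owner dag-n10-c's RESIDUAL CENSUS v18 «displayed binder classes»).  WHICH reading ∕ coordinates ∕ background class ∕ transporter letters the N10 term of
record uses is NODE 00's ∕ def-T's word — NOT claimed here; a LOCATED INSTANCE.

WHAT THIS FILE PROVES (all `theorem`s; `i : KIdx` def-Y's index; `N ≥ 1`; `G ≤ U(N)`; `hNf : N₀ = Nf`).
* §1 `card_support_gradK_le_two` (`#{z : ∂(b,z) ≠ 0} ≤ 2`), ★ `sum_abs_gradK_le` (`Σ_z |∂(b,z)| ≤ 2|c_f|` — the station's `hCgR` WITH `C_∂ = 2|c_f|`), ★ `sum_abs_divK_le`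
  (`Σ_z |∂*(z,b)| ≤ 2|c_f|` — `hCdC`); also serve dag-n10-w2's `B13GreenSymLettersOfReg335` (same binders).
* §2 ★★★ `rawEntryLetters_toMatrix_GAY_prodCfg_of_pencil_located` — the G-station with every NODE-00 ∕ reading ∕ basis numeral a number and `hLoc` discharged by
  `B13DeltaAPencilLettersLocated.rawEntryLetters_toMatrix_localDeltaA_prodCfg_located`.
HONEST FRAMING: located instance; the numbers are finite-lattice constants at the coarsest scale (NOT optimised, NOT print's `O(1)`); the OPERATOR-side inputs `hR` (carrying
Theorems 3.1 ∕ 3.2 at `U₀` through the R-station) and N06's `hunit ∕ hO` (Theorems 3.3 ∕ 3.10 for `Δ_a`, bond sector — NOT in the tree on (3.35)) are DISPLAYED, not proved;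
nothing of Bałaban's asserted; N06 ∕ N10 NOT discharged; K1⁸ stmt-QuantumFields-26907 OPEN, no registered stub proved; counts unmoved (typed 28∕28 · discharged 5∕27);
0 `def`, 0 `sorry`, standard axioms; one finite 𝕋⁴ programme at fixed ε, Bałaban AS PRINTED — R4 closes the conditional finite-𝕋⁴ rung `BalabanLadder.UV` only; the YM mass
gap (Clay) is NOT proved by any of this; nothing continuum ∕ ℝ⁴ ∕ OS.

References: T. Bałaban, CMP 99 (1985) 389–434 [Balaban1985BackgroundPropagators] (3.3) p.391, (3.8) p.392, (3.25)–(3.27) pp.394–395, Thm 3.3 p.399, Thm 3.4 and (3.50)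
p.400, (3.84)–(3.86) p.407, Thm 3.10 (3.107)–(3.108) pp.415–416; CMP 116 (1988) 1–22 [Balaban1988RG2Cluster] (2.5)–(2.7) pp.12–13, p.15; CMP 96 (1984) 223–250
[Balaban1984PropagatorsII] (2.7)–(2.8) p.224, (2.54) p.232, Lemma 2.1 (2.61) p.234.

v1.0.1 (DOCSTRING-ONLY; declarations byte-identical): locator NIT of ref-F READ-580 (HOME INBOX l.≈37190) — «(3.3) p.390» ↦ p.391 ([B9] CMP 99: the covariant
derivative (3.3) is printed at the top of p. 391) in the header, the References line and two theorem docstrings.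
-/

noncomputable section

namespace Literature.MathematicalPhysics.QuantumFieldTheory.Balaban1983to89.B13GreenStationLocated

open Finset Module
open scoped Matrix Matrix.Norms.L2Operator
open Literature.MathematicalPhysics.QuantumFieldTheory.Balaban1983to89
open Literature.MathematicalPhysics.QuantumFieldTheory.Balaban1983to89.B9Thm37GlueTorus (tdist1)
open Literature.MathematicalPhysics.QuantumFieldTheory.Balaban1983to89.B5TorusCover (UT)
open Literature.MathematicalPhysics.QuantumFieldTheory.Balaban1983to89.B13EntrywiseWalks (RawEntryLetters)
open Literature.MathematicalPhysics.QuantumFieldTheory.Balaban1983to89.B9Eq39Adjoint (prodCfg)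
open Literature.MathematicalPhysics.QuantumFieldTheory.Balaban1983to89.B6GlobalChartV1 (PV boxEquiv)
open Literature.MathematicalPhysics.QuantumFieldTheory.Balaban1983to89.B6KLevelCensusIndexV1 (KIdx)
open Literature.MathematicalPhysics.QuantumFieldTheory.Balaban1983to89.Node00
  (SiteY FBondY CfgY SiteParY SiteOpY gradK divK RY deltaAY GAY parBY toKT gradK_ne_zero_cases divK_eq_transpose)
open Literature.MathematicalPhysics.QuantumFieldTheory.Balaban1983to89.B9Eq3104CutoffCommutatorSizes (abs_gradK_le)
open Literature.MathematicalPhysics.QuantumFieldTheory.Balaban1983to89.B13OpsYPencilGreen (rawEntryLetters_toMatrix_GAY_prodCfg_of_pencil)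
open Literature.MathematicalPhysics.QuantumFieldTheory.Balaban1983to89.B13DeltaAPencilLettersLocated (rawEntryLetters_toMatrix_localDeltaA_prodCfg_located)
open Literature.MathematicalPhysics.QuantumFieldTheory.Balaban1983to89.B13SiteReadingNumerals (fineReadingY)
open Literature.MathematicalPhysics.QuantumFieldTheory.Balaban1983to89.B13BlockBondReadingNumerals
  (bondReadingY hℓG_bondReadingY hℓD_bondReadingY card_fibre_bondReadingY_matrixUnits)
open Literature.MathematicalPhysics.QuantumFieldTheory.Balaban1983to89.B13MatrixUnitBasisNumerals (norm_stdBasis_repr_le norm_stdBasis_le_one)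
open Literature.MathematicalPhysics.QuantumFieldTheory.Balaban1983to89.B13GreenPrimeSymLettersOfReg335 (norm_unit_le_one_of_mem)

variable {d ℓ : ℕ} {hd : 1 ≤ d + 1} {hL : Odd (ℓ + 1) ∧ 1 < ℓ + 1} {b₀ b₁ : ℝ}
variable (i : KIdx d ℓ hd hL b₀ b₁)

/-! ## §1. The gradient's row and column sums: `C_∂ = C_∂* = 2|c_f|` -/

section Gradient

open Classical in
/-- the gradient kernel `∂(b, ·)` is supported on the bond's two chart ends: `#{z : ∂(b,z) ≠ 0} ≤ 2` (`Node00.gradK_ne_zero_cases`).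
[cite: Balaban1985BackgroundPropagators, (3.3) p.391; Balaban1984PropagatorsII, (2.7) p.224, bookkeeping] -/
theorem card_support_gradK_le_two (bb : FBondY i) : (univ.filter fun z : SiteY i => gradK i bb z ≠ 0).card ≤ 2 := by
  have hsub : (univ.filter fun z : SiteY i => gradK i bb z ≠ 0) ⊆ {boxEquiv i.hN bb.tgt, boxEquiv i.hN bb.src} := by
    intro z hz
    rw [Finset.mem_filter] at hz
    rcases gradK_ne_zero_cases i hz.2 with h | h
    · rw [h]; exact Finset.mem_insert_self _ _
    · rw [h]; exact Finset.mem_insert_of_mem (Finset.mem_singleton_self _)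
  exact (Finset.card_le_card hsub).trans (Finset.card_le_two)

open Classical in
/-- ★ **THE GRADIENT's ROW SUM `Σ_z |∂(b,z)| ≤ 2|c_f|`** — dag-n10-w2's G-station binder `hCgR` (and `B13GreenSymLettersOfReg335`'s) WITH THE NUMBER `C_∂ = 2|c_f|` (print: `2` in
units `c_f = 1`): two ends, entries `±c_f` (n06's `abs_gradK_le`). [cite: Balaban1985BackgroundPropagators, (3.3) p.391, (3.108) p.416; Balaban1984PropagatorsII, (2.7) p.224; Balaban1988RG2Cluster, (2.5) p.12] -/
theorem sum_abs_gradK_le (bb : FBondY i) : ∑ z, |gradK i bb z| ≤ 2 * |i.cf| := by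
  rw [← Finset.sum_filter_ne_zero]
  have hf : (univ.filter fun z : SiteY i => |gradK i bb z| ≠ 0) = (univ.filter fun z : SiteY i => gradK i bb z ≠ 0) := by
    ext z; simp
  rw [hf]
  calc ∑ z ∈ univ.filter (fun z : SiteY i => gradK i bb z ≠ 0), |gradK i bb z|
      ≤ ∑ _z ∈ univ.filter (fun z : SiteY i => gradK i bb z ≠ 0), |i.cf| := Finset.sum_le_sum fun z _ => abs_gradK_le i bb z
    _ = (univ.filter fun z : SiteY i => gradK i bb z ≠ 0).card * |i.cf| := by rw [Finset.sum_const, nsmul_eq_mul]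
    _ ≤ 2 * |i.cf| := by
        have h2 : ((univ.filter fun z : SiteY i => gradK i bb z ≠ 0).card : ℝ) ≤ 2 := by exact_mod_cast card_support_gradK_le_two i bb
        exact mul_le_mul_of_nonneg_right h2 (abs_nonneg _)

/-- ★ **THE DIVERGENCE's COLUMN SUM `Σ_z |∂*(z,b)| ≤ 2|c_f|`** — the station's `hCdC` WITH `C_∂* = 2|c_f|` (`∂* = ∂ᵀ`, `Node00.divK_eq_transpose`).
[cite: Balaban1985BackgroundPropagators, (3.8) p.392, (3.108) p.416; Balaban1984PropagatorsII, (2.8) p.224; Balaban1988RG2Cluster, (2.5) p.12] -/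
theorem sum_abs_divK_le (bb : FBondY i) : ∑ z, |divK i z bb| ≤ 2 * |i.cf| := by
  have h : ∀ z, divK i z bb = gradK i bb z := fun z => by rw [divK_eq_transpose, Matrix.transpose_apply]
  simp only [h]
  exact sum_abs_gradK_le i bb

end Gradient

/-! ## §2. ★★★ The G-station LOCATED at `(M_N(ℂ), matrix units, fineReadingY ∕ bondReadingY, G-valued U₀ with G ≤ U(N))` -/

section Located

variable {N : ℕ} [NeZero N] {G : Subgroup (Matrix (Fin N) (Fin N) ℂ)ˣ}
variable {Nf : Fin (d + 1) → ℕ} [∀ μ, NeZero (Nf μ)]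
variable (parS : SiteParY (Matrix (Fin N) (Fin N) ℂ) i) (Gp : SiteOpY (Matrix (Fin N) (Fin N) ℂ) i)

open Classical in
/-- ★★★ **dag-n10-w2's G-STATION LOCATED — `G(e^{iηA′}U₀)` IN N10 COORDINATES FROM R's PENCIL LETTERS, EVERY NODE-00 NUMERAL A NUMBER.**  For a `G`-valued background `U₀`
(`G ≤ U(N)`), in matrix-unit coordinates, sites read by `fineReadingY`, bonds by `bondReadingY`: `B13OpsYPencilGreen.rawEntryLetters_toMatrix_GAY_prodCfg_of_pencil` with
`hLoc := B13DeltaAPencilLettersLocated.rawEntryLetters_toMatrix_localDeltaA_prodCfg_located` (76 §4 located), `C_∂ = C_∂* = 2|c_f|` (§1), `r′ = 1`, `m_F = (d+1)·N²`,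
`K₀ = 1`, `cb = cl = 1`, `parB := parBY`.  DISPLAYED ONLY: the R-station's output `hR` (rate `ρ`, radius `Rd`, constant `B_R`, at the fine reading), N06's `IsUnit (Δ_a(U₀))`
and the pointwise (3.108)-type bound of `G(U₀)` (`B_Γ ≥ 0`, rate `ρ` through `bondReadingY`), `hG`, `hU₀`, `hNf`, `η`, `0 < Rd`, `0 ≤ ρ′ < ρ`.
[cite: Balaban1985BackgroundPropagators, (3.25)–(3.27) pp.394–395, Thm 3.4 and (3.50) p.400, (3.84)–(3.86) p.407, Thm 3.10 (3.107)–(3.108) p.416; Balaban1988RG2Cluster, (2.5)–(2.7) pp.12–13, p.15; Balaban1984PropagatorsII, (2.54) p.232, Lemma 2.1 (2.61) p.234] -/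
theorem rawEntryLetters_toMatrix_GAY_prodCfg_of_pencil_located
    (hG : G ≤ B7Prop2Explicit.unitaryUnits (Matrix (Fin N) (Fin N) ℂ))
    {U₀ : CfgY (Matrix (Fin N) (Fin N) ℂ) i} (hU₀ : ∀ μ x, U₀ μ x ∈ G)
    (hNf : ∀ μ, (toKT i).NB μ = Nf μ) (η : ℝ) {Rd : ℝ} (hRpos : 0 < Rd) {ρ BR : ℝ} (hρ : 0 ≤ ρ)
    (hR : RawEntryLetters (fun a : Fin (d + 1) → Site (PV d ℓ i.m i.K hd hL) 0 → Matrix (Fin N) (Fin N) ℂ =>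
      LinearMap.toMatrix ((Pi.basis fun _ : SiteY i => Matrix.stdBasis ℂ (Fin N) (Fin N)).reindex (Equiv.sigmaEquivProd (SiteY i) (Fin N × Fin N)))
        ((Pi.basis fun _ : SiteY i => Matrix.stdBasis ℂ (Fin N) (Fin N)).reindex (Equiv.sigmaEquivProd (SiteY i) (Fin N × Fin N))) (RY i parS Gp (prodCfg U₀ η a)))
      (fun q : SiteY i × (Fin N × Fin N) => fineReadingY i hNf q.1) Rd ρ BR)
    (hunit : IsUnit (deltaAY i parS (parBY i) Gp U₀)) {BΓ : ℝ} (hBΓ : 0 ≤ BΓ)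
    (hO : ∀ x y (E : Matrix (Fin N) (Fin N) ℂ), ‖GAY i parS (parBY i) Gp U₀ (Pi.single x E) y‖ ≤
      BΓ * ‖E‖ * Real.exp (-(ρ * tdist1 Nf (bondReadingY i hNf y) (bondReadingY i hNf x))))
    {ρ' : ℝ} (hρ'0 : 0 ≤ ρ') (hρ' : ρ' < ρ) :
    RawEntryLetters (fun a : Fin (d + 1) → Site (PV d ℓ i.m i.K hd hL) 0 → Matrix (Fin N) (Fin N) ℂ =>
        LinearMap.toMatrix ((Pi.basis fun _ : FBondY i => Matrix.stdBasis ℂ (Fin N) (Fin N)).reindex (Equiv.sigmaEquivProd (FBondY i) (Fin N × Fin N)))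
          ((Pi.basis fun _ : FBondY i => Matrix.stdBasis ℂ (Fin N) (Fin N)).reindex (Equiv.sigmaEquivProd (FBondY i) (Fin N × Fin N)))
          (GAY i parS (parBY i) Gp (prodCfg U₀ η a)))
      (fun p : FBondY i × (Fin N × Fin N) => bondReadingY i hNf p.1)
      (Rd / (4 * ((
(1 * (((4 * ((d : ℝ) + 1) * |i.cf|) * (1 * Real.exp (|η| * Rd) *
          ((1 * Real.exp (|η| * Rd)) ^ 4 * ((4 * |i.cf|) * (1 * Real.exp (|η| * Rd) * 1 * (1 * Real.exp (|η| * Rd))))) *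
          (1 * Real.exp (|η| * Rd))) +
        1 / 2 * ((4 * ((d : ℝ) + 1)) * (1 * Real.exp (|η| * Rd) *
          (2 * (i.cf ^ 2 * (1 * Real.exp (|η| * Rd)) ^ 4) * (8 * (1 * Real.exp (|η| * Rd) * 1 * (1 * Real.exp (|η| * Rd))))) *
          (1 * Real.exp (|η| * Rd))))) +
      2 * ((1 * Real.exp (|η| * Rd)) ^ ((d + 2) * ((ℓ + 1) ^ i.k - 1)) *
        ((|b₁| * i.cf ^ 2 * ((((ℓ + 1 : ℕ) : ℝ)) ^ i.k) ^ (d + 1)) * (1 * ((1 * Real.exp (|η| * Rd)) ^ ((d + 2) * ((ℓ + 1) ^ i.k - 1)) * 1 * (1 * Real.exp (|η| * Rd)) ^ ((d + 2) * ((ℓ + 1) ^ i.k - 1))))) * (1 * Real.exp (|η| * Rd)) ^ ((d + 2) * ((ℓ + 1) ^ i.k - 1)))) * Real.exp (ρ * (2 * (((d : ℝ) + 2) * ((((ℓ + 1) ^ i.k : ℕ) : ℝ) - 1)))))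
 + (2 * |i.cf|) * (Fintype.card (Fin N × Fin N)) * (1 * (1 * Real.exp (|η| * Rd) * 1 * (1 * Real.exp (|η| * Rd)))) *
          ((2 * |i.cf|) * (Fintype.card (Fin N × Fin N)) * (1 * (1 * Real.exp (|η| * Rd) * 1 * (1 * Real.exp (|η| * Rd))))) * BR * Real.exp (2 * ρ * 1)) *
          (1 * 1 * BΓ) * ((((d + 1) * (N * N) : ℕ) : ℝ) * B6.c0 1 ((ρ - ρ') / 3) ^ (d + 1)) * ((((d + 1) * (N * N) : ℕ) : ℝ) * B6.c0 1 ((ρ - ρ') / 3) ^ (d + 1))) + 1))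
      ρ' (2 * (1 * 1 * BΓ)) :=
  rawEntryLetters_toMatrix_GAY_prodCfg_of_pencil i (Matrix.stdBasis ℂ (Fin N) (Fin N)) U₀ η parS (parBY i) Gp (norm_unit_le_one_of_mem i hG hU₀).1
    (norm_unit_le_one_of_mem i hG hU₀).2 le_rfl hRpos (by positivity) (sum_abs_gradK_le i) (by positivity) (sum_abs_divK_le i) norm_stdBasis_repr_le
    zero_le_one norm_stdBasis_le_one zero_le_one (fineReadingY i hNf) (bondReadingY i hNf) (hℓG_bondReadingY i hNf) (hℓD_bondReadingY i hNf)
    (card_fibre_bondReadingY_matrixUnits i hNf) hρ hR (rawEntryLetters_toMatrix_localDeltaA_prodCfg_located i hG hU₀ hNf η hRpos.le hρ) hunit hBΓ hO hρ'0 hρ'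

end Located

end Literature.MathematicalPhysics.QuantumFieldTheory.Balaban1983to89.B13GreenStationLocated

end
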